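import Mathlib

/-!
# Words over `Fin 3` and ordered digit products (toolkit for the `cw₂` group-rigidity theorem)

Support file for `SoloInformedCwTwoGroupRigidity` (soloist door D6: group realizations of
Kronecker powers of the Coppersmith–Winograd tensor `cw₂`, after Alman–Vassilevska Williams,
arXiv:1810.08671, Thm. 7.2).  Words are `u : Fin N → Fin 3`; a family of *digits* is
`g : Fin N → Fin 3 → G` in a (possibly non-abelian) group `G`.

* `digitProd g u m = g 0 (u 0) * ⋯ * g (m-1) (u (m-1))` — the ORDERED digit product, with
  `digitProd_mem`, `commute_digitProd`, and the key identity `digitProd_adm`: for pairwise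
  commuting digits with `g k 0 = 1`, along every admissible triple (`{u_k,v_k,w_k} = {0,1,2}` for
  all `k`) one has `P u * P v * P w = P 1 * P 2`.
* small `decide`d facts about `Fin 3` (third letter `-a-b`, avoiding letters, the shift triple
  `a+1, a+2, a`), a group rearrangement, and the `splice_*` lemmas describing how the word
  `(i ↦ if i < m then p i else q i)` changes when the cut `m` moves (an `update`).

No `sorry`; axioms `propext`, `Classical.choice`, `Quot.sound`.
-/

namespace Summit.MatrixMultiplication.MatrixMultiplication.Theorems

open Function

section CwTwoDigits

variable {G : Type*} [Group G] {N : ℕ}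

/-- Ordered product of the digits of a word below position `m`:
`digitProd g u m = g 0 (u 0) * g 1 (u 1) * ⋯ * g (m-1) (u (m-1))` (factors with index `≥ N`
are `1`). -/
def digitProd (g : Fin N → Fin 3 → G) (u : Fin N → Fin 3) : ℕ → G
  | 0 => 1
  | m + 1 => digitProd g u m * (if h : m < N then g ⟨m, h⟩ (u ⟨m, h⟩) else 1)

/-- Digit products stay in any subgroup containing the digits. -/
theorem digitProd_mem (g : Fin N → Fin 3 → G) (H : Subgroup G) (hg : ∀ k a, g k a ∈ H)
    (u : Fin N → Fin 3) (m : ℕ) : digitProd g u m ∈ H := by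
  induction m with
  | zero => exact H.one_mem
  | succ m ih =>
    simp only [digitProd]
    split_ifs with hm
    · exact H.mul_mem ih (hg _ _)
    · simpa using ih

/-- An element commuting with every digit commutes with every digit product. -/
theorem commute_digitProd (g : Fin N → Fin 3 → G) (u : Fin N → Fin 3) {x : G}
    (hx : ∀ k a, Commute x (g k a)) (m : ℕ) : Commute x (digitProd g u m) := by
  induction m with
  | zero => exact Commute.one_right x
  | succ m ih =>
    simp only [digitProd]
    split_ifs with hm
    · exact ih.mul_right (hx _ _)
    · simpa using ih

/-- For pairwise commuting digits with `g k 0 = 1`: along an admissible triple of words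
(`{u_k, v_k, w_k} = {0,1,2}` for every `k`) the digit products multiply to the constant
`P 1 * P 2`. -/
theorem digitProd_adm (g : Fin N → Fin 3 → G) (hg0 : ∀ k, g k 0 = 1)
    (hcomm : ∀ k l a c, Commute (g k a) (g l c)) (u v w : Fin N → Fin 3)
    (hadm : ∀ i, u i ≠ v i ∧ v i ≠ w i ∧ u i ≠ w i) (m : ℕ) :
    digitProd g u m * digitProd g v m * digitProd g w m =
      digitProd g (fun _ => 1) m * digitProd g (fun _ => 2) m := by
  induction m with
  | zero => simp [digitProd]
  | succ m ih =>
    simp only [digitProd]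
    split_ifs with hm
    · set k : Fin N := ⟨m, hm⟩
      -- the three letters at position `k` are a permutation of `0,1,2`
      have hletters : g k (u k) * g k (v k) * g k (w k) = g k 1 * g k 2 := by
        obtain ⟨h1, h2, h3⟩ := hadm k
        have hc := hcomm k k 1 2
        generalize hu : u k = x at h1 h2 h3 ⊢
        generalize hv : v k = y at h1 h2 h3 ⊢
        generalize hw : w k = z at h1 h2 h3 ⊢
        fin_cases x <;> fin_cases y <;> fin_cases z <;> simp_all [hc.eq]
      -- rearrange using commutativity
      have c1 : Commute (g k (u k)) (digitProd g v m) :=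
        commute_digitProd g v (fun l a => hcomm k l (u k) a) m
      have c2 : Commute (g k (u k)) (digitProd g w m) :=
        commute_digitProd g w (fun l a => hcomm k l (u k) a) m
      have c3 : Commute (g k (v k)) (digitProd g w m) :=
        commute_digitProd g w (fun l a => hcomm k l (v k) a) m
      have c4 : Commute (g k 1) (digitProd g (fun _ => (2 : Fin 3)) m) :=
        commute_digitProd g _ (fun l a => hcomm k l 1 a) m
      calc digitProd g u m * g k (u k) * (digitProd g v m * g k (v k)) *
            (digitProd g w m * g k (w k))
          = digitProd g u m * digitProd g v m * digitProd g w m *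
              (g k (u k) * g k (v k) * g k (w k)) := by
            simp only [mul_assoc]
            rw [← mul_assoc (g k (u k)) (digitProd g v m), c1.eq, mul_assoc (digitProd g v m),
              ← mul_assoc (g k (u k)) (g k (v k)), ← mul_assoc (g k (u k) * g k (v k)),
              show g k (u k) * g k (v k) * digitProd g w m = digitProd g w m * (g k (u k) * g k (v k))
                from by rw [mul_assoc, c3.eq, ← mul_assoc, c2.eq, mul_assoc]]
            simp only [mul_assoc]
        _ = digitProd g (fun _ => 1) m * digitProd g (fun _ => 2) m * (g k 1 * g k 2) := by
            rw [hletters, ih]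
        _ = digitProd g (fun _ => 1) m * g k 1 * (digitProd g (fun _ => 2) m * g k 2) := by
            simp only [mul_assoc]
            rw [← mul_assoc (digitProd g (fun _ => (2 : Fin 3)) m) (g k 1), ← c4.eq, mul_assoc]
    · simpa using ih

/-- Two distinct letters of `Fin 3` and the third one `-a-b`. -/
theorem fin3_third_ne : ∀ a b : Fin 3, a ≠ b → b ≠ -a - b ∧ a ≠ -a - b := by decide

/-- The third letter is symmetric in the two given ones. -/
theorem fin3_third_symm : ∀ a b : Fin 3, -a - b = -b - a := by decide

/-- A letter of `Fin 3` avoiding two given ones. -/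
theorem fin3_avoid_ne : ∀ a b : Fin 3,
    (if a = b then a + 1 else -a - b) ≠ a ∧ (if a = b then a + 1 else -a - b) ≠ b := by decide

/-- `a + 1`, `a + 2`, `a` are pairwise distinct in `Fin 3`. -/
theorem fin3_shift_adm : ∀ a : Fin 3, a + 1 ≠ a + 2 ∧ a + 2 ≠ a ∧ a + 1 ≠ a := by decide

/-- A basic rearrangement in a group: `X * C = Y * D` gives `Y⁻¹ * X = D * C⁻¹`. -/
theorem inv_mul_eq_mul_inv_of_mul_eq_mul {X Y C D : G} (h : X * C = Y * D) :
    Y⁻¹ * X = D * C⁻¹ := by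
  calc Y⁻¹ * X = Y⁻¹ * (X * C) * C⁻¹ := by group
    _ = Y⁻¹ * (Y * D) * C⁻¹ := by rw [h]
    _ = D * C⁻¹ := by group

/-- Splicing two words at position `m`: moving the cut one step to the right is an `update`. -/
theorem splice_succ (p q : Fin N → Fin 3) {m : ℕ} (hm : m < N) (c : Fin 3) (hc : p ⟨m, hm⟩ = c) :
    (fun i : Fin N => if (i : ℕ) < m + 1 then p i else q i) =
      update (fun i : Fin N => if (i : ℕ) < m then p i else q i) ⟨m, hm⟩ c := by
  subst hc
  funext i
  by_cases hi : i = ⟨m, hm⟩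
  · subst hi; simp
  · have hne : (i : ℕ) ≠ m := fun e => hi (Fin.ext e)
    simp only [update_apply, if_neg hi]
    by_cases him : (i : ℕ) < m
    · simp [him, Nat.lt_succ_of_lt him]
    · have : ¬ (i : ℕ) < m + 1 := by omega
      simp [him, this]

/-- The spliced word already carries the letter `q m` at the cut. -/
theorem splice_update_cut (p q : Fin N → Fin 3) {m : ℕ} (hm : m < N) (c : Fin 3)
    (hc : q ⟨m, hm⟩ = c) :
    update (fun i : Fin N => if (i : ℕ) < m then p i else q i) ⟨m, hm⟩ c =
      (fun i : Fin N => if (i : ℕ) < m then p i else q i) := by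
  subst hc; rw [update_eq_iff]; exact ⟨by simp, fun j _ => rfl⟩

/-- Beyond the last coordinate the cut position is immaterial. -/
theorem splice_stable (p q : Fin N → Fin 3) {m : ℕ} (hm : ¬ m < N) :
    (fun i : Fin N => if (i : ℕ) < m + 1 then p i else q i) =
      (fun i : Fin N => if (i : ℕ) < m then p i else q i) := by
  funext i
  have h1 : (i : ℕ) < m := by omega
  have h2 : (i : ℕ) < m + 1 := by omega
  simp [h1, h2]

/-- Cutting at `N` keeps the whole first word. -/
theorem splice_top (p q : Fin N → Fin 3) :
    (fun i : Fin N => if (i : ℕ) < N then p i else q i) = p := by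
  funext i; simp [i.isLt]

end CwTwoDigits

end Summit.MatrixMultiplication.MatrixMultiplication.Theorems
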